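import Summits.CriticalPhenomena.PercolationContinuityZ3.Theorems.PercNearOneGluingNoHeavyLowerTailMajorityGluingSix
import HarnessLib

/-!
# The maj3 TRIGGER bound: `μ(at least two of three relays cut) ≤ (9/8)·max_i μ(vᵢ ↮ a₀)` from ONE mixed van den Berg–Kahn row (lane prim-rate, constants-miner 1, gen 33; CANDIDATES §GEN-33 R321)

Support file for the closed crux `NoHeavyLowerTail` (stmt-CriticalPhenomena-4575), majority-gluing line.  For a hub `a₀` and three relays
`v_i, v_j, v_k` with `μ(v ↮ a₀) ≤ δ`:  **`μ(some two of the three are cut from a₀) ≤ (9/8)·δ`** (`twoOfThree_trigger`).  `9/8 = max_r P(Bin(3,r) ≥ 2)/r`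
is the TRIGGER constant: the value of the hub-rooted van den Berg–Kahn programme with the GENERAL (connection + avoidance) rows of
[VandenbergKahn2001, Thm 1.2] (numerically the value over all laws, kit j264690; the uniform majority-of-three bound `≤ δ` is false,
`…MajorityGluingMajThreeRefutation`, so the best constant lies in `[1.001, 9/8]`).  This is the three-relay model of the six-relay trigger
bound conjectured for the root cell `R_4` (CANDIDATES R319) and the lane's first use of a MIXED row:
* ROW (van den Berg–Kahn Thm 1.1 = Thm 1.2 with `A = {v_j}, B = {v_k}, X = Y = {v_i}`; tree `BergKahn.bergKahn_thm_1_1`):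
  `μ(v_j att, v_i cut)·μ(v_k att, v_i cut) ≤ μ(v_j, v_k att, v_i cut)·μ(v_i cut)`, i.e. on the atoms `p_S = μ(exactly S cut)`: `p_{ij}·p_{ik} ≤ p_i·p_{ijk}`;
* CHOICE: `v_i` = the relay whose atom `e_i = μ(v_i att, the other two cut)` is smallest, so `e_i ≤ p_{ij}, p_{ik}`;
* ALGEBRA (`maj3Trigger_atoms`): with `x = p_{ij}/p_{ijk} ≤ y = p_{ik}/p_{ijk}`: `9(1+x)(1+y) − 8(1+2x+y) = (3x−1)² + (y−x)(9x+1) ≥ 0`, whence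
  `8·μ(≥ 2 cut) ≤ 8(e_i + p_{ij} + p_{ik} + p_{ijk}) ≤ 9(p_i + p_{ij} + p_{ik} + p_{ijk}) = 9·μ(v_i cut) ≤ 9δ`.
Equality for the programme at the trigger law `r = 3/4`.  No definitions, no sorries. [cite: VandenbergKahn2001, Thm 1.1 (p. 123)]
-/

noncomputable section

namespace Summit.CriticalPhenomena.PercolationContinuityZ3.Theorems

open MeasureTheory Set
open Literature.Probability.LatticeModels (prodBernoulli)
open Literature.Probability.Percolation
open scoped Classical

namespace HubOnly

variable {n : ℕ}

/-! ### The real-variable core -/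

/-- **Atom form.** `p1 = μ(only v_i cut)`, `a = p_{ij}`, `b = p_{ik}`, `e = μ(v_i att, v_j, v_k cut)`, `c = p_{ijk}`, all `≥ 0`; the case hypothesis
`e ≤ a`, `e ≤ b`; the van den Berg–Kahn row `a·b ≤ p1·c`; the marginal `p1 + a + b + c ≤ δ`.  Then `μ(≥ 2 cut) = e + a + b + c ≤ (9/8)·δ`.
Key identity (case `a ≤ b`): `9cδ − 8c(e+a+b+c) = 9c(δ − p1 − a − b − c) + 9(p1·c − a·b) + (3a − c)² + (b − a)(9a + c) + 8c(a − e)`. [folklore] -/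
theorem maj3Trigger_atoms (δ p1 a b e c : ℝ) (h1 : 0 ≤ p1) (ha : 0 ≤ a) (hb : 0 ≤ b) (he : 0 ≤ e) (hc : 0 ≤ c)
    (hea : e ≤ a) (heb : e ≤ b) (hrow : a * b ≤ p1 * c) (hδ : p1 + a + b + c ≤ δ) :
    e + a + b + c ≤ 9 / 8 * δ := by
  rcases eq_or_lt_of_le hc with hc0 | hcpos
  · -- `c = 0`: the row forces `a·b = 0`, hence `e = 0`
    have hab0 : a * b = 0 := by
      have : a * b ≤ 0 := by rw [← hc0, mul_zero] at hrow; exact hrow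
      exact le_antisymm this (mul_nonneg ha hb)
    have he0 : e = 0 := by
      rcases mul_eq_zero.1 hab0 with ha0 | hb0
      · exact le_antisymm (ha0 ▸ hea) he
      · exact le_antisymm (hb0 ▸ heb) he
    rw [he0, ← hc0]; linarith
  · have key : 8 * (c * (e + a + b + c)) ≤ 9 * (c * δ) := by
      rcases le_total a b with hab | hba
      · nlinarith [sq_nonneg (3 * a - c), mul_nonneg (sub_nonneg.2 hab) (by positivity : (0 : ℝ) ≤ 9 * a + c),
          mul_nonneg hc (sub_nonneg.2 hea), mul_nonneg hc (sub_nonneg.2 hδ), sub_nonneg.2 hrow]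
      · nlinarith [sq_nonneg (3 * b - c), mul_nonneg (sub_nonneg.2 hba) (by positivity : (0 : ℝ) ≤ 9 * b + c),
          mul_nonneg hc (sub_nonneg.2 heb), mul_nonneg hc (sub_nonneg.2 hδ), sub_nonneg.2 hrow]
    have h2 : c * (e + a + b + c) ≤ c * (9 / 8 * δ) := by nlinarith [key]
    exact le_of_mul_le_mul_left h2 hcpos

/-- **Cylinder form.** `q = μ(v_i cut) ≤ δ`, `gj = μ(v_j att, v_i cut)`, `gk = μ(v_k att, v_i cut)`, `gjk = μ(v_j, v_k att, v_i cut)`,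
`e = μ(v_i att, v_j, v_k cut)` with the inclusion–exclusion facts `gjk ≤ gj`, `gjk ≤ gk`, `gj + gk − gjk ≤ q`, the case hypothesis
`e ≤ gk − gjk`, `e ≤ gj − gjk` and the row `gj·gk ≤ gjk·q`: then `q − gjk + e ≤ (9/8)·δ`. [folklore] -/
theorem maj3Trigger_cyl (δ q gj gk gjk e : ℝ) (hgjk : 0 ≤ gjk) (he : 0 ≤ e) (h1 : gjk ≤ gj) (h2 : gjk ≤ gk)
    (h3 : gj + gk - gjk ≤ q) (hq : q ≤ δ) (hea : e ≤ gk - gjk) (heb : e ≤ gj - gjk) (hrow : gj * gk ≤ gjk * q) :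
    q - gjk + e ≤ 9 / 8 * δ := by
  have h := maj3Trigger_atoms δ gjk (gk - gjk) (gj - gjk) e (q - gj - gk + gjk) hgjk (sub_nonneg.2 h2) (sub_nonneg.2 h1) he
    (by linarith) hea heb (by nlinarith [hrow]) (by linarith)
  linarith

/-! ### The percolation theorem -/

/-- **maj3 trigger bound, oriented form.**  Hub `a₀`, relays `i, j, k`; if `μ(i cut) ≤ δ` and the atom «`i` attached, `j, k` cut» is not larger
than the atoms «`j` attached, `i, k` cut» and «`k` attached, `i, j` cut», then `μ(some two of i, j, k cut) ≤ (9/8)·δ`.  The row is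
`BergKahn.bergKahn_thm_1_1 a₀ j k i`. [cite: VandenbergKahn2001, Thm 1.1 (p. 123)] -/
theorem twoOfThree_trigger_of_min (w : Sym2 (Fin n) → unitInterval) (a₀ i j k : Fin n) (δ : ℝ)
    (hδ : (prodBernoulli w).real (openConn a₀ i : Set (BondConfig (Fin n)))ᶜ ≤ δ)
    (hmin1 : (prodBernoulli w).real ((openConn a₀ i : Set (BondConfig (Fin n))) ∩ (openConn a₀ j)ᶜ ∩ (openConn a₀ k)ᶜ) ≤
      (prodBernoulli w).real ((openConn a₀ j : Set (BondConfig (Fin n))) ∩ (openConn a₀ i)ᶜ ∩ (openConn a₀ k)ᶜ))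
    (hmin2 : (prodBernoulli w).real ((openConn a₀ i : Set (BondConfig (Fin n))) ∩ (openConn a₀ j)ᶜ ∩ (openConn a₀ k)ᶜ) ≤
      (prodBernoulli w).real ((openConn a₀ k : Set (BondConfig (Fin n))) ∩ (openConn a₀ i)ᶜ ∩ (openConn a₀ j)ᶜ)) :
    (prodBernoulli w).real {ω : BondConfig (Fin n) | (ω ∉ openConn a₀ i ∧ ω ∉ openConn a₀ j) ∨
        (ω ∉ openConn a₀ i ∧ ω ∉ openConn a₀ k) ∨ (ω ∉ openConn a₀ j ∧ ω ∉ openConn a₀ k)} ≤ 9 / 8 * δ := by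
  set μ := prodBernoulli w with hμ
  have hms : ∀ S : Set (BondConfig (Fin n)), MeasurableSet S := fun _ => MeasurableSet.of_discrete
  set Ci : Set (BondConfig (Fin n)) := openConn a₀ i with hCi
  set Cj : Set (BondConfig (Fin n)) := openConn a₀ j with hCj
  set Ck : Set (BondConfig (Fin n)) := openConn a₀ k with hCk
  -- cylinder events
  set Gj : Set (BondConfig (Fin n)) := Cj ∩ Ciᶜ with hGj
  set Gk : Set (BondConfig (Fin n)) := Ck ∩ Ciᶜ with hGk
  set Gjk : Set (BondConfig (Fin n)) := Cj ∩ Ck ∩ Ciᶜ with hGjk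
  set Ei : Set (BondConfig (Fin n)) := Ci ∩ Cjᶜ ∩ Ckᶜ with hEi
  -- the row (van den Berg–Kahn Thm 1.1 with s = a₀, a = j, b = k, t = i)
  have hrow : μ.real Gj * μ.real Gk ≤ μ.real Gjk * μ.real Ciᶜ := by
    have h := BergKahn.bergKahn_thm_1_1 w a₀ j k i
    simpa only [hGj, hGk, hGjk, hCi, hCj, hCk, hμ] using h
  -- inclusion–exclusion facts
  have hGjk_j : Gj ∩ Ck = Gjk := by
    ext ω; simp only [hGj, hGjk, mem_inter_iff, mem_compl_iff]; tauto
  have hGjk_k : Gk ∩ Cj = Gjk := by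
    ext ω; simp only [hGk, hGjk, mem_inter_iff, mem_compl_iff]; tauto
  have hEj : Gj \ Ck = Cj ∩ Ciᶜ ∩ Ckᶜ := by
    ext ω; simp only [hGj, mem_sdiff, mem_inter_iff, mem_compl_iff]
  have hEk : Gk \ Cj = Ck ∩ Ciᶜ ∩ Cjᶜ := by
    ext ω; simp only [hGk, mem_sdiff, mem_inter_iff, mem_compl_iff]
  have h1 : μ.real Gjk ≤ μ.real Gj := by
    rw [← hGjk_j]; exact measureReal_mono inter_subset_left
  have h2 : μ.real Gjk ≤ μ.real Gk := by
    rw [← hGjk_k]; exact measureReal_mono inter_subset_left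
  have hunion : μ.real (Gj ∪ Gk) + μ.real (Gj ∩ Gk) = μ.real Gj + μ.real Gk := measureReal_union_add_inter (μ := μ) (s := Gj) (hms Gk)
  have hGjGk : Gj ∩ Gk = Gjk := by
    ext ω; simp only [hGj, hGk, hGjk, mem_inter_iff, mem_compl_iff]; tauto
  have hsub : Gj ∪ Gk ⊆ Ciᶜ := by
    intro ω hω
    rcases hω with h | h
    · exact h.2
    · exact h.2
  have h3 : μ.real Gj + μ.real Gk - μ.real Gjk ≤ μ.real Ciᶜ := by
    rw [hGjGk] at hunion
    have := measureReal_mono (μ := μ) hsub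
    linarith
  -- the case hypotheses as differences
  have hEj' : μ.real (Cj ∩ Ciᶜ ∩ Ckᶜ) = μ.real Gj - μ.real Gjk := by
    have h := measureReal_inter_add_sdiff (μ := μ) (s := Gj) (hms Ck)
    rw [hGjk_j, hEj] at h; linarith
  have hEk' : μ.real (Ck ∩ Ciᶜ ∩ Cjᶜ) = μ.real Gk - μ.real Gjk := by
    have h := measureReal_inter_add_sdiff (μ := μ) (s := Gk) (hms Cj)
    rw [hGjk_k, hEk] at h; linarith
  -- the event «some two cut» inside `(Ciᶜ \ Gjk) ∪ Ei`
  have hS : {ω : BondConfig (Fin n) | (ω ∉ Ci ∧ ω ∉ Cj) ∨ (ω ∉ Ci ∧ ω ∉ Ck) ∨ (ω ∉ Cj ∧ ω ∉ Ck)} ⊆ (Ciᶜ \ Gjk) ∪ Ei := by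
    intro ω hω
    simp only [mem_setOf_eq, mem_union, mem_sdiff, mem_compl_iff, hGjk, hEi, mem_inter_iff] at hω ⊢
    tauto
  have hdiff : μ.real (Ciᶜ \ Gjk) = μ.real Ciᶜ - μ.real Gjk := by
    have h := measureReal_inter_add_sdiff (μ := μ) (s := Ciᶜ) (hms Gjk)
    have hI : Ciᶜ ∩ Gjk = Gjk := by
      ext ω; simp only [hGjk, mem_inter_iff, mem_compl_iff]; tauto
    rw [hI] at h; linarith
  have hT : μ.real {ω : BondConfig (Fin n) | (ω ∉ Ci ∧ ω ∉ Cj) ∨ (ω ∉ Ci ∧ ω ∉ Ck) ∨ (ω ∉ Cj ∧ ω ∉ Ck)} ≤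
      μ.real Ciᶜ - μ.real Gjk + μ.real Ei := by
    calc μ.real {ω : BondConfig (Fin n) | (ω ∉ Ci ∧ ω ∉ Cj) ∨ (ω ∉ Ci ∧ ω ∉ Ck) ∨ (ω ∉ Cj ∧ ω ∉ Ck)}
        ≤ μ.real ((Ciᶜ \ Gjk) ∪ Ei) := measureReal_mono hS
      _ ≤ μ.real (Ciᶜ \ Gjk) + μ.real Ei := measureReal_union_le _ _
      _ = μ.real Ciᶜ - μ.real Gjk + μ.real Ei := by rw [hdiff]
  -- the real lemma
  have hfin := maj3Trigger_cyl δ (μ.real Ciᶜ) (μ.real Gj) (μ.real Gk) (μ.real Gjk) (μ.real Ei) measureReal_nonneg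
    measureReal_nonneg h1 h2 h3 hδ (by rw [← hEk']; exact hmin2) (by rw [← hEj']; exact hmin1) hrow
  exact hT.trans hfin

/-- **THE maj3 TRIGGER BOUND.**  For Bernoulli bond percolation with arbitrary weights on the pairs of `Fin n`, a hub `a₀` and relays `i, j, k`
with `μ(v ↮ a₀) ≤ δ` for `v ∈ {i, j, k}`: **`μ(some two of i, j, k are cut from a₀) ≤ (9/8)·δ`** — the relay with the smallest atom
«attached, the other two cut» plays the role of `i` in `twoOfThree_trigger_of_min`. [cite: VandenbergKahn2001, Thm 1.1 (p. 123)] -/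
theorem twoOfThree_trigger (w : Sym2 (Fin n) → unitInterval) (a₀ i j k : Fin n) (δ : ℝ)
    (hδi : (prodBernoulli w).real (openConn a₀ i : Set (BondConfig (Fin n)))ᶜ ≤ δ)
    (hδj : (prodBernoulli w).real (openConn a₀ j : Set (BondConfig (Fin n)))ᶜ ≤ δ)
    (hδk : (prodBernoulli w).real (openConn a₀ k : Set (BondConfig (Fin n)))ᶜ ≤ δ) :
    (prodBernoulli w).real {ω : BondConfig (Fin n) | (ω ∉ openConn a₀ i ∧ ω ∉ openConn a₀ j) ∨
        (ω ∉ openConn a₀ i ∧ ω ∉ openConn a₀ k) ∨ (ω ∉ openConn a₀ j ∧ ω ∉ openConn a₀ k)} ≤ 9 / 8 * δ := by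
  set μ := prodBernoulli w with hμ
  set Ci : Set (BondConfig (Fin n)) := openConn a₀ i with hCi
  set Cj : Set (BondConfig (Fin n)) := openConn a₀ j with hCj
  set Ck : Set (BondConfig (Fin n)) := openConn a₀ k with hCk
  -- the three atoms «one attached, the other two cut», in the two inter-orders that occur
  have ejk : (Cj : Set (BondConfig (Fin n))) ∩ Ckᶜ ∩ Ciᶜ = Cj ∩ Ciᶜ ∩ Ckᶜ := by
    ext ω; simp only [mem_inter_iff, mem_compl_iff]; tauto
  have ekj : (Ck : Set (BondConfig (Fin n))) ∩ Cjᶜ ∩ Ciᶜ = Ck ∩ Ciᶜ ∩ Cjᶜ := by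
    ext ω; simp only [mem_inter_iff, mem_compl_iff]; tauto
  have eik : (Ci : Set (BondConfig (Fin n))) ∩ Ckᶜ ∩ Cjᶜ = Ci ∩ Cjᶜ ∩ Ckᶜ := by
    ext ω; simp only [mem_inter_iff, mem_compl_iff]; tauto
  -- the target set is symmetric in (i, j, k)
  have sj : {ω : BondConfig (Fin n) | (ω ∉ Cj ∧ ω ∉ Ci) ∨ (ω ∉ Cj ∧ ω ∉ Ck) ∨ (ω ∉ Ci ∧ ω ∉ Ck)} =
      {ω : BondConfig (Fin n) | (ω ∉ Ci ∧ ω ∉ Cj) ∨ (ω ∉ Ci ∧ ω ∉ Ck) ∨ (ω ∉ Cj ∧ ω ∉ Ck)} := by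
    ext ω; simp only [mem_setOf_eq]; tauto
  have sk : {ω : BondConfig (Fin n) | (ω ∉ Ck ∧ ω ∉ Ci) ∨ (ω ∉ Ck ∧ ω ∉ Cj) ∨ (ω ∉ Ci ∧ ω ∉ Cj)} =
      {ω : BondConfig (Fin n) | (ω ∉ Ci ∧ ω ∉ Cj) ∨ (ω ∉ Ci ∧ ω ∉ Ck) ∨ (ω ∉ Cj ∧ ω ∉ Ck)} := by
    ext ω; simp only [mem_setOf_eq]; tauto
  set ei := μ.real (Ci ∩ Cjᶜ ∩ Ckᶜ) with hei
  set ej := μ.real (Cj ∩ Ciᶜ ∩ Ckᶜ) with hej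
  set ek := μ.real (Ck ∩ Ciᶜ ∩ Cjᶜ) with hek
  rcases le_total ei ej with hij | hji
  · rcases le_total ei ek with hik | hki
    · exact twoOfThree_trigger_of_min w a₀ i j k δ hδi hij hik
    · -- `ek` minimal
      have hkj : ek ≤ ej := hki.trans hij
      have hki' : μ.real (Ck ∩ Ciᶜ ∩ Cjᶜ) ≤ μ.real (Ci ∩ Ckᶜ ∩ Cjᶜ) := by rw [eik]; exact hki
      have hkj' : μ.real (Ck ∩ Ciᶜ ∩ Cjᶜ) ≤ μ.real (Cj ∩ Ckᶜ ∩ Ciᶜ) := by rw [ejk]; exact hkj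
      have h : μ.real {ω : BondConfig (Fin n) | (ω ∉ Ck ∧ ω ∉ Ci) ∨ (ω ∉ Ck ∧ ω ∉ Cj) ∨ (ω ∉ Ci ∧ ω ∉ Cj)} ≤ 9 / 8 * δ :=
        twoOfThree_trigger_of_min w a₀ k i j δ hδk hki' hkj'
      rw [sk] at h; exact h
  · rcases le_total ej ek with hjk | hkj
    · -- `ej` minimal
      have hji' : μ.real (Cj ∩ Ciᶜ ∩ Ckᶜ) ≤ μ.real (Ci ∩ Cjᶜ ∩ Ckᶜ) := hji
      have hjk' : μ.real (Cj ∩ Ciᶜ ∩ Ckᶜ) ≤ μ.real (Ck ∩ Cjᶜ ∩ Ciᶜ) := by rw [ekj]; exact hjk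
      have h : μ.real {ω : BondConfig (Fin n) | (ω ∉ Cj ∧ ω ∉ Ci) ∨ (ω ∉ Cj ∧ ω ∉ Ck) ∨ (ω ∉ Ci ∧ ω ∉ Ck)} ≤ 9 / 8 * δ :=
        twoOfThree_trigger_of_min w a₀ j i k δ hδj hji' hjk'
      rw [sj] at h; exact h
    · -- `ek` minimal
      have hki : ek ≤ ei := hkj.trans hji
      have hki' : μ.real (Ck ∩ Ciᶜ ∩ Cjᶜ) ≤ μ.real (Ci ∩ Ckᶜ ∩ Cjᶜ) := by rw [eik]; exact hki
      have hkj' : μ.real (Ck ∩ Ciᶜ ∩ Cjᶜ) ≤ μ.real (Cj ∩ Ckᶜ ∩ Ciᶜ) := by rw [ejk]; exact hkj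
      have h : μ.real {ω : BondConfig (Fin n) | (ω ∉ Ck ∧ ω ∉ Ci) ∨ (ω ∉ Ck ∧ ω ∉ Cj) ∨ (ω ∉ Ci ∧ ω ∉ Cj)} ≤ 9 / 8 * δ :=
        twoOfThree_trigger_of_min w a₀ k i j δ hδk hki' hkj'
      rw [sk] at h; exact h

end HubOnly

end Summit.CriticalPhenomena.PercolationContinuityZ3.Theorems

end
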